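import Summits.BirchSwinnertonDyer.BirchSwinnertonDyer.Theorems.KolyvaginRankRigidityAtTwoTransverseHomogeneous
import Summits.BirchSwinnertonDyer.BirchSwinnertonDyer.Theorems.KolyvaginRankRigidityAtTwoSwapPairingUpperBoundAtTwo
import Summits.BirchSwinnertonDyer.BirchSwinnertonDyer.Theorems.ClassRecordThreeEulerHalvesAtThreeWalkSupplyTransverse
import Summits.BirchSwinnertonDyer.BirchSwinnertonDyer.Theorems.Rank1ResidualJetRowDualityPrep
import Literature.NumberTheory.GaloisRepresentations.LocalGlobalCohomologyDualityProofs
import HarnessLib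

/-!
# Crux V2♭θ / V2♭∞ (stmt-BirchSwinnertonDyer-27220; line `kolyvagin_depth_split`), stub S1, piece P8 —
# the TRANSVERSE PACKAGE at `2`: a Selmer structure that is self-dual at EVERY finite place, homogeneous and
# Lagrangian at the Kolyvagin places of index `≥ M + 1`, Kummer elsewhere; discharge of `h𝒯sd` and `hP7b`

The S1 composition `primeSwapAtTwoLossy_core[_frob]` (p627412 / p630413) takes a family of transverse
structures `𝒯 M` with the binder `h𝒯sd : ∀ M c, ∀ v ∈ placesDividing K c, w⁻¹((𝒯 M)_v^*) = (𝒯 M)_v` quantified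
over ALL `c` (it is used at `c = n·ℓ`, a product of Kolyvagin primes of index `≥ M + 1`). The ring-class transverse
condition is Lagrangian only at Kolyvagin places with margin (p632205), so we feed the composition the HYBRID
structure «transverse (`⨅_{w' ∣ λ} ker(H¹(K_λ) → H¹(K[ℓ]_{w'}))`) at the Kolyvagin places of index `≥ M + 1`,
unramified (Kummer) elsewhere» — Mazur–Rubin's modified Selmer structure `𝓕(c)` read place by place. For ANY
structure `𝒯` described place-wise by these two clauses this file proves:
* `dualTransported_eq_of_eq_iInf_transverse` (Kolyvagin place of index `≥ M + 1`, `1 ≤ M`: p632205's Lagrangian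
  theorem + `transverseSubgroup_adicCompletion_eq_of_liesOver`), `dualTransported_eq_of_eq_kummer` (`1 ≤ M`: Tate
  local duality, `GaloisImage.dualTransported_kummerSelmerStructure_inr`), `dualTransported_eq_of_level_one`
  (`M = 0`: `H¹(K_v, E[1]) = 0`) ⇒ `dualTransported_eq_of_hybrid` — the binder `h𝒯sd` at every finite place;
* `hybrid_pure` — (pure) at the Kolyvagin places (p634857 `iInf_transverseSubgroup_ringClassField_homogeneous`);
* `pow_smul_localTatePairingZMod_eq_zero_of_hybrid` — the binder `hP7b` of the composition (constant `c₇' = 0`),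
  from the width seat's `pow_smul_localTatePairingZMod_eq_zero_of_transverse_add` (p629363) fed with (iso)+(pure).
HONEST FRAMING: helper (`--supports` 27220); S1 / V2♭θ / BSD are NOT proved here.
References: [cite: MazurRubin2004, Def. 1.1.6, Prop. 1.3.2 (ii)] [cite: Howard2004HeegnerKolyvagin, Def. 2.1.6,
Prop. 2.1.9 (ii)] [cite: Kolyvagin1991MathAnn, §2 (proof of Thm. 2.2)] [cite: MilneADT2006, Ch. I, Cor. 3.4].
-/

set_option autoImplicit false
-- the Theorems namespace of this sub repeats the summit name by design (D-0017 nested layout)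
set_option linter.dupNamespace false

noncomputable section

open scoped Classical Pointwise

namespace Summit.BirchSwinnertonDyer.BirchSwinnertonDyer.Theorems.KolyvaginLowerBoundAtTwo

open CategoryTheory ContinuousCohomology WeierstrassCurve Field Function NumberField IsDedekindDomain
open Literature.NumberTheory.EllipticCurves Literature.NumberTheory.EllipticCurves.Jetchev2008
open Literature.NumberTheory.GaloisRepresentations Literature.NumberTheory.GaloisCohomology
open Literature.NumberTheory.GaloisRepresentations.DiscreteGaloisModule (localTatePairingZMod tateDual
  transverseSubgroup SelmerStructure)
open Literature.NumberTheory.Automorphic _root_.TopRep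
open Summit.BirchSwinnertonDyer.Rank1Residual.GaloisImage
open Summit.BirchSwinnertonDyer.Rank1Residual
open Summit.BirchSwinnertonDyer.Rank1Residual.JET.RingClassTransverse
open Summit.BirchSwinnertonDyer.Rank1Residual.JET.SelmerVocabulary
open scoped ContRepresentation NumberField

variable {K : Type} [Field K] [NumberField K] (W : WeierstrassCurve ℚ) [W.IsElliptic] [W.IsGloballyMinimal]
  [(W.baseChange K).IsElliptic]
  (M : ℕ) [NeZero (2 ^ M)] [Finite (geomTorsion (W.baseChange K) ((2 ^ M : ℕ) : ℤ))]
  (e : geomTorsion (W.baseChange K) ((2 ^ M : ℕ) : ℤ) → geomTorsion (W.baseChange K) ((2 ^ M : ℕ) : ℤ) →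
    AlgebraicClosure K)
  (hμ : ∀ S T, e S T ^ (2 ^ M) = 1)
  (hadd₁ : ∀ S₁ S₂ T, e (S₁ + S₂) T = e S₁ T * e S₂ T)
  (hadd₂ : ∀ S T₁ T₂, e S (T₁ + T₂) = e S T₁ * e S T₂)
  (hgal : ∀ (g : absoluteGaloisGroup K) (S T : geomTorsion (W.baseChange K) ((2 ^ M : ℕ) : ℤ)),
    g • e S T = e (g • S) (g • T))
  (halt : ∀ T, e T T = 1) (hnondeg : ∀ T, (∀ S, e S T = 1) → T = 0)
  (inv : LocalInvariants K (2 ^ M))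
  (𝒯 : SelmerStructure ((W.baseChange K).torsionGaloisModule ((2 ^ M : ℕ) : ℤ)))

/-! ## §1 Self-duality at every finite place -/

omit [Finite (geomTorsion (W.baseChange K) ((2 ^ M : ℕ) : ℤ))] in
include hnondeg in
/-- **Kolyvagin place of index `≥ M + 1`**: if `𝒯_v = ⨅_{w' ∣ v} H¹_tr(K_v → K[ℓ]_{w'})` for a Zhang–Kolyvagin
prime `ℓ ∈ v` at `2` with `M + 1 ≤ M(ℓ)` (`1 ≤ M`), then `w⁻¹(𝒯_v^*) = 𝒯_v` (Lagrangian, p632205).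
[cite: Howard2004HeegnerKolyvagin, Prop. 2.1.9 (ii)] [cite: MazurRubin2004, Prop. 1.3.2 (ii)] -/
theorem dualTransported_eq_of_eq_iInf_transverse (hK : IsImaginaryQuadratic K) (hD : NumberField.discr K < -4)
    (ι : K →+* ℂ) [∀ j : ℕ, NumberField (ringClassField K ι j)] (hM : 1 ≤ M)
    (hinv : ∀ v : HeightOneSpectrum (𝓞 K), Injective (inv (Sum.inr v)))
    (v : HeightOneSpectrum (𝓞 K)) {ℓ : ℕ} (hℓ : Zhang2014.IsKolyvaginPrime (W.conductorNorm ℤ) W K 2 ℓ)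
    (hMℓ : M + 1 ≤ Zhang2014.kolyvaginIndex W 2 ℓ) (hv : (ℓ : 𝓞 K) ∈ v.asIdeal)
    (h𝒯v : 𝒯 (Sum.inr v) = ⨅ (w' : HeightOneSpectrum (𝓞 (ringClassField K ι ℓ)))
        (_ : w'.asIdeal.LiesOver v.asIdeal),
        letI := (adicCompletionOfLiesOver K (ringClassField K ι ℓ) v w').toAlgebra
        transverseSubgroup (GaloisRep.toLocal v ((W.baseChange K).torsionGaloisModule ((2 ^ M : ℕ) : ℤ)))
          (w'.adicCompletion (ringClassField K ι ℓ))) :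
    inv.dualTransported 𝒯 (weilDualIntertwining (W.baseChange K) (2 ^ M) e hμ hadd₁ hadd₂ hgal) (Sum.inr v) =
      𝒯 (Sum.inr v) := by
  have hℓ0 : ℓ ≠ 0 := hℓ.1.ne_zero
  -- a place `w₀ ∣ v` of `K[ℓ]`; `𝒯_v` is the transverse subgroup at `w₀`
  haveI := (finiteDimensional_and_isGalois_ringClassField hK ι hℓ0).2
  obtain ⟨w₀⟩ := (inferInstance : Nonempty (SemiLocal.Place K (ringClassField K ι ℓ) v))
  haveI hw₀ : (w₀ : HeightOneSpectrum (𝓞 (ringClassField K ι ℓ))).asIdeal.LiesOver v.asIdeal :=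
    SemiLocal.Place.liesOver w₀
  letI := (adicCompletionOfLiesOver K (ringClassField K ι ℓ) v
    (w₀ : HeightOneSpectrum (𝓞 (ringClassField K ι ℓ)))).toAlgebra
  have h𝒯v' : 𝒯 (Sum.inr v) =
      transverseSubgroup (GaloisRep.toLocal v ((W.baseChange K).torsionGaloisModule ((2 ^ M : ℕ) : ℤ)))
        ((w₀ : HeightOneSpectrum (𝓞 (ringClassField K ι ℓ))).adicCompletion (ringClassField K ι ℓ)) := by
    rw [h𝒯v]
    ext y
    simp only [AddSubgroup.mem_iInf]
    constructor
    · intro H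
      exact H (w₀ : HeightOneSpectrum (𝓞 (ringClassField K ι ℓ))) hw₀
    · intro hy w' hw'
      rw [transverseSubgroup_adicCompletion_eq_of_liesOver
        ((W.baseChange K).torsionGaloisModule ((2 ^ M : ℕ) : ℤ)) (ringClassField K ι ℓ) v w'
        (w₀ : HeightOneSpectrum (𝓞 (ringClassField K ι ℓ)))]
      exact hy
  rw [X5.SelfDualCount.dualTransported_weilDual_eq_annRight (W.baseChange K) (2 ^ M) e hμ hadd₁ hadd₂ hgal inv 𝒯
    (Sum.inr v), h𝒯v']
  exact annRight_invWeilPairing_transverseSubgroup_ringClassField_eq_two W K hK hD ι hM hℓ hMℓ v hv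
    (w₀ : HeightOneSpectrum (𝓞 (ringClassField K ι ℓ))) e hμ hadd₁ hadd₂ hgal hnondeg inv (hinv v)

omit [W.IsElliptic] [W.IsGloballyMinimal] in
include halt hnondeg in
/-- **Kummer place** (`1 ≤ M`): if `𝒯_v = Kum_v` then `w⁻¹(𝒯_v^*) = 𝒯_v` (Tate local duality for `E[2^M]`,
`GaloisImage.dualTransported_kummerSelmerStructure_inr`; the transported dual depends on the local condition only).
[cite: MilneADT2006, Ch. I, Cor. 3.4] -/
theorem dualTransported_eq_of_eq_kummer (hM : 1 ≤ M)
    (hinv : ∀ v : HeightOneSpectrum (𝓞 K), Injective (inv (Sum.inr v)))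
    (v : HeightOneSpectrum (𝓞 K))
    (h𝒯v : 𝒯 (Sum.inr v) = (W.baseChange K).kummerSelmerStructure ((2 ^ M : ℕ) : ℤ) (Sum.inr v)) :
    inv.dualTransported 𝒯 (weilDualIntertwining (W.baseChange K) (2 ^ M) e hμ hadd₁ hadd₂ hgal) (Sum.inr v) =
      𝒯 (Sum.inr v) := by
  have hN : IsPrimePow (2 ^ M) := ⟨2, M, Nat.prime_two.prime, hM, rfl⟩
  haveI : CharZero (v.adicCompletion K) := charZero_of_injective_algebraMap (algebraMap K _).injective
  rw [JET.GlobalDuality.dualTransported_congr W (2 ^ M) e hμ hadd₁ hadd₂ hgal inv h𝒯v, h𝒯v]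
  exact GaloisImage.dualTransported_kummerSelmerStructure_inr (W.baseChange K) (2 ^ M) e hμ hadd₁ hadd₂ hgal halt
    hnondeg hN v (localEulerPoincareCharacteristic_holds (v.adicCompletion K)) inv (hinv v)

omit [NeZero (2 ^ M)] [Finite (geomTorsion (W.baseChange K) ((2 ^ M : ℕ) : ℤ))] [W.IsElliptic]
  [W.IsGloballyMinimal] [(W.baseChange K).IsElliptic] in
/-- **Level one** (`M = 0`): `H¹(K_v, E[1]) = 0`, so any two local conditions agree. [folklore] -/
theorem addSubgroup_galoisCohomology_eq_of_level_zero (hM : M = 0) (v : Place K)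
    (A B : AddSubgroup (galoisCohomology
      (((W.baseChange K).torsionGaloisModule ((2 ^ M : ℕ) : ℤ)).toLocal v) 1)) : A = B := by
  subst hM
  have h0 : ∀ c : galoisCohomology (((W.baseChange K).torsionGaloisModule ((2 ^ 0 : ℕ) : ℤ)).toLocal v) 1,
      c = 0 := fun c ↦ by
    have h := galoisCohomology.nsmul_eq_zero_of_forall
      (((W.baseChange K).torsionGaloisModule ((2 ^ 0 : ℕ) : ℤ)).toLocal v)
      (fun P : geomTorsion (W.baseChange K) ((2 ^ 0 : ℕ) : ℤ) ↦ AddSubgroup.torsionBy.nsmul P) c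
    have h1 : (1 : ℕ) • c = 0 := h
    rwa [one_nsmul] at h1
  ext c
  rw [h0 c]
  exact ⟨fun _ ↦ zero_mem _, fun _ ↦ zero_mem _⟩

include halt hnondeg in
/-- **`h𝒯sd` for the hybrid structure at EVERY finite place**: if at each finite place `𝒯_v` is either the
ring-class transverse condition of a Kolyvagin prime `ℓ ∈ v` of index `≥ M + 1` or the Kummer condition, then
`w⁻¹(𝒯_v^*) = 𝒯_v`. [cite: MazurRubin2004, Def. 1.1.6, Prop. 1.3.2 (ii)] [cite: MilneADT2006, Ch. I, Cor. 3.4] -/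
theorem dualTransported_eq_of_hybrid (hK : IsImaginaryQuadratic K) (hD : NumberField.discr K < -4)
    (ι : K →+* ℂ) [∀ j : ℕ, NumberField (ringClassField K ι j)]
    (hinv : ∀ v : HeightOneSpectrum (𝓞 K), Injective (inv (Sum.inr v)))
    (hhyb : ∀ v : HeightOneSpectrum (𝓞 K),
      (∃ ℓ : ℕ, Zhang2014.IsKolyvaginPrime (W.conductorNorm ℤ) W K 2 ℓ ∧
        M + 1 ≤ Zhang2014.kolyvaginIndex W 2 ℓ ∧ (ℓ : 𝓞 K) ∈ v.asIdeal ∧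
        𝒯 (Sum.inr v) = ⨅ (w' : HeightOneSpectrum (𝓞 (ringClassField K ι ℓ)))
          (_ : w'.asIdeal.LiesOver v.asIdeal),
          letI := (adicCompletionOfLiesOver K (ringClassField K ι ℓ) v w').toAlgebra
          transverseSubgroup (GaloisRep.toLocal v ((W.baseChange K).torsionGaloisModule ((2 ^ M : ℕ) : ℤ)))
            (w'.adicCompletion (ringClassField K ι ℓ))) ∨
      𝒯 (Sum.inr v) = (W.baseChange K).kummerSelmerStructure ((2 ^ M : ℕ) : ℤ) (Sum.inr v))
    (c : ℕ) : ∀ v ∈ placesDividing K c,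
      inv.dualTransported 𝒯 (weilDualIntertwining (W.baseChange K) (2 ^ M) e hμ hadd₁ hadd₂ hgal) (Sum.inr v) =
        𝒯 (Sum.inr v) := by
  intro v _
  rcases Nat.eq_zero_or_pos M with hM0 | hM
  · exact addSubgroup_galoisCohomology_eq_of_level_zero W M hM0 (Sum.inr v) _ _
  rcases hhyb v with ⟨ℓ, hℓ, hMℓ, hv, h𝒯v⟩ | h𝒯v
  · exact dualTransported_eq_of_eq_iInf_transverse W M e hμ hadd₁ hadd₂ hgal hnondeg inv 𝒯 hK hD ι hM hinv v
      hℓ hMℓ hv h𝒯v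
  · exact dualTransported_eq_of_eq_kummer W M e hμ hadd₁ hadd₂ hgal halt hnondeg inv 𝒯 hM hinv v h𝒯v

/-! ## §2 (pure) at the Kolyvagin places, and the binder `hP7b` -/

omit [NeZero (2 ^ M)] [Finite (geomTorsion (W.baseChange K) ((2 ^ M : ℕ) : ℤ))] [(W.baseChange K).IsElliptic] in
/-- **(pure) for the hybrid structure at a Kolyvagin place** `v ∋ q` of index `≥ M` where `𝒯_v` is the ring-class
transverse condition (p634857). [cite: Rubin2011, Prop. 1.9.5 (1)] -/
theorem hybrid_pure (hK : IsImaginaryQuadratic K) (hD : NumberField.discr K < -4)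
    (ι : K →+* ℂ) [∀ j : ℕ, NumberField (ringClassField K ι j)] [NeZero (2 ^ M)]
    (v : HeightOneSpectrum (𝓞 K)) {q : ℕ} (hq : Zhang2014.IsKolyvaginPrime (W.conductorNorm ℤ) W K 2 q)
    (hMq : M ≤ Zhang2014.kolyvaginIndex W 2 q) (hv : (q : 𝓞 K) ∈ v.asIdeal)
    (h𝒯v : 𝒯 (Sum.inr v) = ⨅ (w' : HeightOneSpectrum (𝓞 (ringClassField K ι q)))
        (_ : w'.asIdeal.LiesOver v.asIdeal),
        letI := (adicCompletionOfLiesOver K (ringClassField K ι q) v w').toAlgebra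
        transverseSubgroup (GaloisRep.toLocal v ((W.baseChange K).torsionGaloisModule ((2 ^ M : ℕ) : ℤ)))
          (w'.adicCompletion (ringClassField K ι q))) :
    ∀ y ∈ 𝒯 (Sum.inr v), ∀ b : ℕ, ((2 ^ b : ℕ) : ℤ) • y = 0 →
      ∃ y' ∈ 𝒯 (Sum.inr v), y = ((2 ^ (M - b) : ℕ) : ℤ) • y' := by
  intro y hy b hb
  haveI : Fact (Nat.Prime 2) := ⟨Nat.prime_two⟩
  rw [h𝒯v] at hy ⊢
  obtain ⟨y', hy', hyy'⟩ := iInf_transverseSubgroup_ringClassField_homogeneous W K hK hD ι M hq hMq v hv hy hb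
  exact ⟨y', hy', hyy'⟩

include hnondeg in
/-- **`hP7b` for the hybrid structure** (constant `c₇' = 0`, but stated with an arbitrary slack `c`): at a
Kolyvagin place `v ∋ q` of index `≥ M + 1` where `𝒯_v` is the ring-class transverse condition, for classes
`w, C` with `loc_v C ∈ 𝒯_v`, `2^{a₀} loc_v w ∈ 𝒯_v`, `2^{b₀} loc_v C = 0`:
`2^{a₀+b₀+c−M} ⟨loc_v w, loc_v (w_* C)⟩_v = 0` — p629363 fed with (iso) (§1) and (pure) (§2).
[cite: Kolyvagin1991MathAnn, §2 (proof of Thm. 2.2)] [cite: McCallumLMS1991, §5 Prop. 5.2] -/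
theorem pow_smul_localTatePairingZMod_eq_zero_of_hybrid (hK : IsImaginaryQuadratic K)
    (hD : NumberField.discr K < -4) (ι : K →+* ℂ) [∀ j : ℕ, NumberField (ringClassField K ι j)]
    (hinv : ∀ v : HeightOneSpectrum (𝓞 K), Injective (inv (Sum.inr v)))
    (v : HeightOneSpectrum (𝓞 K)) {q : ℕ} (hq : Zhang2014.IsKolyvaginPrime (W.conductorNorm ℤ) W K 2 q)
    (hMq : M + 1 ≤ Zhang2014.kolyvaginIndex W 2 q) (hv : (q : 𝓞 K) ∈ v.asIdeal)
    (h𝒯v : 𝒯 (Sum.inr v) = ⨅ (w' : HeightOneSpectrum (𝓞 (ringClassField K ι q)))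
        (_ : w'.asIdeal.LiesOver v.asIdeal),
        letI := (adicCompletionOfLiesOver K (ringClassField K ι q) v w').toAlgebra
        transverseSubgroup (GaloisRep.toLocal v ((W.baseChange K).torsionGaloisModule ((2 ^ M : ℕ) : ℤ)))
          (w'.adicCompletion (ringClassField K ι q)))
    (w C : galoisCohomology ((W.baseChange K).torsionGaloisModule ((2 ^ M : ℕ) : ℤ)) 1) {a₀ b₀ : ℕ} (c : ℕ)
    (hCT : galoisCohomology.localization ((W.baseChange K).torsionGaloisModule ((2 ^ M : ℕ) : ℤ)) (Sum.inr v) 1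
      C ∈ 𝒯 (Sum.inr v))
    (hwT : ((2 ^ a₀ : ℕ) : ℤ) •
      galoisCohomology.localization ((W.baseChange K).torsionGaloisModule ((2 ^ M : ℕ) : ℤ)) (Sum.inr v) 1 w ∈
        𝒯 (Sum.inr v))
    (hC0 : ((2 ^ b₀ : ℕ) : ℤ) •
      galoisCohomology.localization ((W.baseChange K).torsionGaloisModule ((2 ^ M : ℕ) : ℤ)) (Sum.inr v) 1 C = 0) :
    (2 ^ (a₀ + b₀ + c - M) : ℕ) •
        localTatePairingZMod ((W.baseChange K).torsionGaloisModule ((2 ^ M : ℕ) : ℤ)) (2 ^ M) (Sum.inr v)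
          (inv (Sum.inr v))
          (galoisCohomology.localization ((W.baseChange K).torsionGaloisModule ((2 ^ M : ℕ) : ℤ)) (Sum.inr v) 1 w)
          (galoisCohomology.localization
            (((W.baseChange K).torsionGaloisModule ((2 ^ M : ℕ) : ℤ)).tateDual (2 ^ M)) (Sum.inr v) 1
            (galoisCohomology.map
              (weilDualIntertwining (W.baseChange K) (2 ^ M) e hμ hadd₁ hadd₂ hgal) 1 C)) = 0 := by
  rcases Nat.eq_zero_or_pos M with hM0 | hM
  · -- level one: the pairing lives in `ZMod 1`
    subst hM0
    haveI : Subsingleton (ZMod (2 ^ 0)) := ZMod.subsingleton_iff.mpr rfl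
    exact Subsingleton.elim _ _
  exact pow_smul_localTatePairingZMod_eq_zero_of_transverse_add W M e hμ hadd₁ hadd₂ hgal inv 𝒯 (Sum.inr v)
    (dualTransported_eq_of_eq_iInf_transverse W M e hμ hadd₁ hadd₂ hgal hnondeg inv 𝒯 hK hD ι hM hinv v hq hMq
      hv h𝒯v)
    (hybrid_pure W M 𝒯 hK hD ι v hq (Nat.le_of_succ_le hMq) hv h𝒯v) w C c hCT hwT hC0

end Summit.BirchSwinnertonDyer.BirchSwinnertonDyer.Theorems.KolyvaginLowerBoundAtTwo

end
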